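import Summits.BirchSwinnertonDyer.BirchSwinnertonDyer.Theorems.EdixhovenFibreFiveSevenStarredOptimalManinUnitFiveSevenRecTowerAtCyclotomicOverExt
import HarnessLib

/-!
# [REC-tower] AT THE CYCLOTOMIC TOWER `ℚ_v ⊆ ℚ(ζ_m)_w` from Kato's formula over the COMPLETION `K_{w′}` of a number field `K ⊇ ℚ(ζ_m)`
# — the TURNKEY form of the K′-package for the cell provers
# (route `EdixhovenFibreFiveSeven`, crux K★ stmt-BirchSwinnertonDyer-22226, line `kato-lever`; seat `bsd-line-edix-p1` g30, LEAD)

HONEST FRAMING. TOOL theorem only (no definition, no named fact, no instance, no `sorry`; file-local instance keys on `ℚ_v` byte-identical to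
`…RecTowerAtCyclotomicOverExt` l.85–89); nothing is closed; BSD / K★ / the REC stubs are NOT proved by this.

WHAT. `…RecTowerAtCyclotomicOverExt.recTowerAt_cyclotomic_cells_of_formula_over_ext` (p784080/p784180) leaves displayed, for a globally minimal `W/ℚ`
in a starred K★ cell and the cyclotomic tower `ℚ_v ⊆ L_w = ℚ(ζ_m)_w`: an ABSTRACT finite `K′ ⊇ L_w` with keys, and Kato's formula over `K′` for the
direct representation (`∀ d″ ∃ c′`). Here `K′ := K_{w′} = w′.adicCompletion K` is the completion of a NUMBER FIELD `K ⊇ ℚ(ζ_m)` (`K/ℚ(ζ_m)` finite —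
e.g. `K = ℚ(ζ_m, ϖ)`, `ϖ^e = p`, the cell's field of good reduction, over which the (K₂)^ram road `…TransportedReciprocityAllPoints` is typed) at a place
`w′ ∣ w`, with the packet's keys `[CharZero] [Fact ¬IsUnit p] [IsAdicComplete] (hp′)` and `LocalField.adicCompletionPadicAlgebra w′ p hw′`:
the structural inputs `Algebra L_w K_{w′}` (`Extension.adicCompletionSemialgHom`), its continuity (`adicCompletionSemialgHom_continuous`) and
`FiniteDimensional L_w K_{w′}` (`e·f = [L_w : K_v]`) all come from the adelic base-change packet (`Literature/NumberTheory/AdelicBaseChange/CompletionBaseChange`,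
Cassels–Fröhlich II §10), so ★★★ `recTowerAt_cyclotomic_cells_of_formula_over_completion` displays ONE analytic input: Kato's formula over `K_{w′}`
for `V_pW|_{Γ_{K_{w′}}}`, for every line datum `d″` some constant `c′`, with ANY compatible valuation `ω′` of `K_{w′}` in `log_ω`.
(Deliberately WITHOUT `backward.isDefEq.respectTransparency false`: under that option the `Module.Finite L_w K_{w′}` instance search diverges.)

References: [Kato1993LNM1553] Ch. II §1.2.4, Prop. 1.2.3, Ex. 1.3.5, Thm. 1.4.1 (4); [BrinonConrad2009] Prop. 6.3.8; [CasselsFrohlichANT1967] Ch. II §10 (10.2);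
[Fontaine1982FormesDifferentielles] §5.
-/

set_option autoImplicit false
-- the Theorems namespace of a single-conjunct summit repeats the summit name by design (D-0017)
set_option linter.dupNamespace false

noncomputable section

open scoped Classical NNReal TensorProduct NumberField
open CategoryTheory Function Field ValuativeRel IsDedekindDomain NumberField
open Literature.NumberTheory.GaloisRepresentations
open Literature.NumberTheory.GaloisRepresentations.IsNonarchimedeanLocalField
open Literature.NumberTheory.GaloisRepresentations.PeriodRingData
open Literature.NumberTheory.PAdicHodge
open Literature.NumberTheory.EllipticCurves _root_.WeierstrassCurve
open Literature.NumberTheory.EllipticCurves.FormalGroupChart (padicLogPointFiniteExt)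
open Summit.BirchSwinnertonDyer.BirchSwinnertonDyer.Theorems.StarredOptimalManinUnitFiveSevenRecTowerAtCyclotomicOverExt
open Summit.BirchSwinnertonDyer.BirchSwinnertonDyer.Theorems.KimAtThreeDeepLowerExpStarOmega
open Summit.BirchSwinnertonDyer.BirchSwinnertonDyer.Theorems.KimAtThreeDeepLowerExpStarOmegaPlace
open Summit.BirchSwinnertonDyer.BirchSwinnertonDyer.Theorems.KimAtThreeDeepUpperTowerLattice (fact_natCast_mem_primesEquiv_symm)
open Summit.BirchSwinnertonDyer.Rank1Residual.GaloisImage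
open Rat.HeightOneSpectrum Literature.NumberTheory.DiophantineGeometry
open Summit.BirchSwinnertonDyer.Rank1Residual Summit.BirchSwinnertonDyer.Rank1Residual.Additive
  Literature.NumberTheory.EllipticCurves.Rank1Residual
open Literature.NumberTheory.AdelicBaseChange

namespace Summit.BirchSwinnertonDyer.BirchSwinnertonDyer.Theorems.StarredOptimalManinUnitFiveSevenRecTowerAtCyclotomicOverCompletion

variable (W : WeierstrassCurve ℚ) [W.IsElliptic] (p : ℕ) [hp : Fact p.Prime]

-- FILE-LOCAL instance keys, byte-identical to the accepted `…RecTowerAtCyclotomicOverExt.lean` l.85–89 (no library instance is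
-- overridden outside this file): the `Fact (p ∈ v_p)` key and the local-field structures on `ℚ_v = Place.Completion (inr v_p)`.
attribute [local instance] fact_natCast_mem_primesEquiv_symm
attribute [local instance 100000] NumberField.Place.instAlgebraCompletion
attribute [local instance] valuativeRelPlace topologicalSpacePlace
attribute [local instance] isNonarchimedeanLocalField_place charZero_place
attribute [local instance] padicAlgebraPlace fact_not_isUnit_place isAdicComplete_place

/-- ★★★ **TURNKEY FORM for the cell provers: the upper field is the COMPLETION `K_{w′}` of a number field `K ⊇ ℚ(ζ_m)` at a place
`w′ ∣ w`, with the packet's keys.** For a globally minimal `W/ℚ` in a starred K★ cell, the [REC-tower] body clause at `ℚ_v ⊆ ℚ(ζ_m)_w` follows from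
Kato's formula for the DIRECT representation `V_pW|_{Γ_{K_{w′}}}` over `K_{w′} = w′.adicCompletion K` (`K/ℚ(ζ_m)` finite, e.g. `K = ℚ(ζ_m, ϖ)` with
`ϖ^e = p`, the cell's field of good reduction), `∀ d″ ∃ c′`, stated with the keys `[CharZero] [Fact ¬IsUnit p] [IsAdicComplete] (hp′)`,
`LocalField.adicCompletionPadicAlgebra w′ p hw′` and ANY compatible valuation `ω′` of `K_{w′}` — every structural input of
`recTowerAt_cyclotomic_cells_of_formula_over_ext` being supplied by the adelic base-change packet: `Algebra L_w K_{w′}` and its continuity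
(`Extension.adicCompletionSemialgHom(_continuous)`), `FiniteDimensional L_w K_{w′}` (`e·f = [L_w : K_v]`, Cassels–Fröhlich II §10), the local-field
structure of `K_{w′}`. [cite: Kato1993LNM1553, Ch. II §1.2.4, Prop. 1.2.3, Ex. 1.3.5 and Thm. 1.4.1 (4)] [cite: BrinonConrad2009, Prop. 6.3.8]
[cite: CasselsFrohlichANT1967, Ch. II §10 Theorem (10.2)] [cite: Fontaine1982FormesDifferentielles, §5] -/
theorem recTowerAt_cyclotomic_cells_of_formula_over_completion [W.IsGloballyMinimal]
    (hp57 : p = 5 ∨ p = 7) (hadd : Addv W p) (hirr : Irr W p)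
    (hIstar : ∀ (v : HeightOneSpectrum ℤ) (n : ℕ), natGenerator v = p → W.kodairaSymbolAt v ≠ KodairaSymbol.Istar n)
    (h4 : 4 < padicValInt p W.minimalDiscriminantInt)
    (m : ℕ) [NeZero m]
    (w : ((primesEquiv (R := 𝓞 ℚ)).symm ⟨p, hp.out⟩).Extension (𝓞 (CyclotomicField m ℚ)))
    (hw : ((p : ℕ) : 𝓞 (CyclotomicField m ℚ)) ∈ w.1.asIdeal)
    [CharZero (w.1.adicCompletion (CyclotomicField m ℚ))]
    [Fact (¬ IsUnit ((p : ℕ) : integerC (w.1.adicCompletion (CyclotomicField m ℚ))))]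
    [IsAdicComplete (Ideal.span {((p : ℕ) : integerC (w.1.adicCompletion (CyclotomicField m ℚ)))}) (integerC (w.1.adicCompletion (CyclotomicField m ℚ)))]
    (hL : valuation (w.1.adicCompletion (CyclotomicField m ℚ)) ((p : ℕ) : (w.1.adicCompletion (CyclotomicField m ℚ))) < 1) :
    letI := LocalField.adicCompletionPadicAlgebra w.1 p hw
    letI : Algebra (Place.Completion (K := ℚ) (Sum.inr ((primesEquiv (R := 𝓞 ℚ)).symm ⟨p, hp.out⟩))) (w.1.adicCompletion (CyclotomicField m ℚ)) :=
      inferInstanceAs (Algebra (((primesEquiv (R := 𝓞 ℚ)).symm ⟨p, hp.out⟩).adicCompletion ℚ) (w.1.adicCompletion (CyclotomicField m ℚ)))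
    ∀ (wv : Valuation (Place.Completion (Sum.inr ((primesEquiv (R := 𝓞 ℚ)).symm ⟨p, hp.out⟩) : Place ℚ)) ℝ≥0) [wv.Compatible] [(W.baseChange (Place.Completion (Sum.inr ((primesEquiv (R := 𝓞 ℚ)).symm ⟨p, hp.out⟩) : Place ℚ))).IsIntegral wv.integer]
      (ν : Valuation (w.1.adicCompletion (CyclotomicField m ℚ)) ℝ≥0) [ν.Compatible] [(W.baseChange (w.1.adicCompletion (CyclotomicField m ℚ))).IsIntegral ν.integer]
      -- the upper field: the completion `K_{w′}` of a number field `K ⊇ ℚ(ζ_m)` at a place `w′ ∣ w`, with the packet's keys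
      {K : Type} [Field K] [NumberField K] [Algebra (CyclotomicField m ℚ) K] [FiniteDimensional (CyclotomicField m ℚ) K]
      (w' : w.1.Extension (𝓞 K)) (hw' : ((p : ℕ) : 𝓞 K) ∈ w'.1.asIdeal)
      [CharZero (w'.1.adicCompletion K)] [Fact (¬ IsUnit ((p : ℕ) : integerC (w'.1.adicCompletion K)))]
      [IsAdicComplete (Ideal.span {((p : ℕ) : integerC (w'.1.adicCompletion K))}) (integerC (w'.1.adicCompletion K))]
      (hp' : valuation (w'.1.adicCompletion K) ((p : ℕ) : (w'.1.adicCompletion K)) < 1)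
      (ω' : Valuation (w'.1.adicCompletion K) ℝ≥0) [ω'.Compatible] [(W.baseChange (w'.1.adicCompletion K)).IsIntegral ω'.integer],
    letI := LocalField.adicCompletionPadicAlgebra w'.1 p hw'
    -- the Weil tower
    ∀ (e : (k : ℕ) → geomTorsion W ((p ^ k : ℕ) : ℤ) → geomTorsion W ((p ^ k : ℕ) : ℤ) → AlgebraicClosure ℚ)
    (hμ : ∀ k S T, e k S T ^ (p ^ k) = 1) (hadd₁ : ∀ k S₁ S₂ T, e k (S₁ + S₂) T = e k S₁ T * e k S₂ T)
    (hadd₂ : ∀ k S T₁ T₂, e k S (T₁ + T₂) = e k S T₁ * e k S T₂)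
    (hgal : ∀ k (σ : absoluteGaloisGroup ℚ) (S T : geomTorsion W ((p ^ k : ℕ) : ℤ)), σ • e k S T = e k (σ • S) (σ • T))
    (hcompat : ∀ k (S T : geomTorsion W ((p ^ (k + 1) : ℕ) : ℤ)),
      e k (torsionMulHom W (p ^ (k + 1)) (p ^ k) p (pow_succ p k).symm S)
        (torsionMulHom W (p ^ (k + 1)) (p ^ k) p (pow_succ p k).symm T) = e (k + 1) S T ^ p)
    (hnondeg : ∀ k (T : geomTorsion W ((p ^ k : ℕ) : ℤ)), (∀ S, e k S T = 1) → T = 0)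
    -- binders of the tower representation over `F = L_w` (relative to `F₀ = ℚ_v`) — the stub's own
    (hinj : (bdRPeriodRingData (F := (w.1.adicCompletion (CyclotomicField m ℚ))) (p := p) hL).CupLogInjective (logCyclotomic p)
      ((restrictedRationalTateRep W (Place.Completion (Sum.inr ((primesEquiv (R := 𝓞 ℚ)).symm ⟨p, hp.out⟩) : Place ℚ)) p).restrict (absGaloisRestrict (Place.Completion (Sum.inr ((primesEquiv (R := 𝓞 ℚ)).symm ⟨p, hp.out⟩) : Place ℚ)) (w.1.adicCompletion (CyclotomicField m ℚ)))))
    (hde : ∀ z : contOneCocycles ((restrictedRationalTateRep W (Place.Completion (Sum.inr ((primesEquiv (R := 𝓞 ℚ)).symm ⟨p, hp.out⟩) : Place ℚ)) p).restrict (absGaloisRestrict (Place.Completion (Sum.inr ((primesEquiv (R := 𝓞 ℚ)).symm ⟨p, hp.out⟩) : Place ℚ)) (w.1.adicCompletion (CyclotomicField m ℚ)))).toTopRep,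
      (bdRPeriodRingData (F := (w.1.adicCompletion (CyclotomicField m ℚ))) (p := p) hL).HasDualExp (logCyclotomic p)
        ((restrictedRationalTateRep W (Place.Completion (Sum.inr ((primesEquiv (R := 𝓞 ℚ)).symm ⟨p, hp.out⟩) : Place ℚ)) p).restrict (absGaloisRestrict (Place.Completion (Sum.inr ((primesEquiv (R := 𝓞 ℚ)).symm ⟨p, hp.out⟩) : Place ℚ)) (w.1.adicCompletion (CyclotomicField m ℚ)))) fun σ => z.1 σ)
    -- line data at `ℚ_v` and `L_w` with their compatibility — the stub's own
    (d₀ : (bdRPeriodRingData (F := (Place.Completion (Sum.inr ((primesEquiv (R := 𝓞 ℚ)).symm ⟨p, hp.out⟩) : Place ℚ))) (p := p) (valuation_place_lt_one p ((primesEquiv (R := 𝓞 ℚ)).symm ⟨p, hp.out⟩))).FilZeroLine (restrictedRationalTateRep W (Place.Completion (Sum.inr ((primesEquiv (R := 𝓞 ℚ)).symm ⟨p, hp.out⟩) : Place ℚ)) p))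
    (d : (bdRPeriodRingData (F := (w.1.adicCompletion (CyclotomicField m ℚ))) (p := p) hL).FilZeroLine ((restrictedRationalTateRep W (Place.Completion (Sum.inr ((primesEquiv (R := 𝓞 ℚ)).symm ⟨p, hp.out⟩) : Place ℚ)) p).restrict (absGaloisRestrict (Place.Completion (Sum.inr ((primesEquiv (R := 𝓞 ℚ)).symm ⟨p, hp.out⟩) : Place ℚ)) (w.1.adicCompletion (CyclotomicField m ℚ)))))
    (hcomp : ∀ (η₀ : contOneCocycles (restrictedTateRep W (Place.Completion (Sum.inr ((primesEquiv (R := 𝓞 ℚ)).symm ⟨p, hp.out⟩) : Place ℚ)) p).toTopRep)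
        (η : contOneCocycles ((restrictedTateRep W (Place.Completion (Sum.inr ((primesEquiv (R := 𝓞 ℚ)).symm ⟨p, hp.out⟩) : Place ℚ)) p).restrict (absGaloisRestrict (Place.Completion (Sum.inr ((primesEquiv (R := 𝓞 ℚ)).symm ⟨p, hp.out⟩) : Place ℚ)) (w.1.adicCompletion (CyclotomicField m ℚ)))).toTopRep),
        (∀ σ, η.1 σ = η₀.1 (absGaloisRestrict (Place.Completion (Sum.inr ((primesEquiv (R := 𝓞 ℚ)).symm ⟨p, hp.out⟩) : Place ℚ)) (w.1.adicCompletion (CyclotomicField m ℚ)) σ)) →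
        expStarCoordTower W hL d η = algebraMap (Place.Completion (Sum.inr ((primesEquiv (R := 𝓞 ℚ)).symm ⟨p, hp.out⟩) : Place ℚ)) (w.1.adicCompletion (CyclotomicField m ℚ)) (expStarCoord W (valuation_place_lt_one p ((primesEquiv (R := 𝓞 ℚ)).symm ⟨p, hp.out⟩)) d₀ η₀))
    -- Kato's formula over `K′` for the DIRECT representation: for every line datum SOME constant (the (K₂)^ram road's output shape)
    (hrecK' : ∀ d'' : (bdRPeriodRingData (F := (w'.1.adicCompletion K)) (p := p) hp').FilZeroLine (restrictedRationalTateRep W (w'.1.adicCompletion K) p), ∃ c' : (w'.1.adicCompletion K),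
      ∀ (η'' : contOneCocycles (restrictedTateRep W (w'.1.adicCompletion K) p).toTopRep) (P' : (W.baseChange (w'.1.adicCompletion K)).toAffine.Point),
      ((tatePairingPoint W (w'.1.adicCompletion K) p e hμ hadd₁ hadd₂ hgal hcompat (oneCocycleClass _ η'') P' : ℤ_[p]) : ℚ_[p]) =
        Algebra.trace ℚ_[p] (w'.1.adicCompletion K) (c' * expStarCoord W hp' d'' η'' * padicLogPointFiniteExt ω' (W.baseChange (w'.1.adicCompletion K)) p P')),
    ∃ c₀ : (Place.Completion (Sum.inr ((primesEquiv (R := 𝓞 ℚ)).symm ⟨p, hp.out⟩) : Place ℚ)), c₀ ≠ 0 ∧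
      (∀ (η₀ : contOneCocycles (restrictedTateRep W (Place.Completion (Sum.inr ((primesEquiv (R := 𝓞 ℚ)).symm ⟨p, hp.out⟩) : Place ℚ)) p).toTopRep) (P₀ : (W.baseChange (Place.Completion (Sum.inr ((primesEquiv (R := 𝓞 ℚ)).symm ⟨p, hp.out⟩) : Place ℚ))).toAffine.Point),
        ((tatePairingPoint W (Place.Completion (Sum.inr ((primesEquiv (R := 𝓞 ℚ)).symm ⟨p, hp.out⟩) : Place ℚ)) p e hμ hadd₁ hadd₂ hgal hcompat (oneCocycleClass _ η₀) P₀ : ℤ_[p]) : ℚ_[p]) =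
          Algebra.trace ℚ_[p] (Place.Completion (Sum.inr ((primesEquiv (R := 𝓞 ℚ)).symm ⟨p, hp.out⟩) : Place ℚ))
            (c₀ * expStarCoord W (valuation_place_lt_one p ((primesEquiv (R := 𝓞 ℚ)).symm ⟨p, hp.out⟩)) d₀ η₀ * padicLogPointFiniteExt wv (W.baseChange (Place.Completion (Sum.inr ((primesEquiv (R := 𝓞 ℚ)).symm ⟨p, hp.out⟩) : Place ℚ))) p P₀)) ∧
      ∀ (η : contOneCocycles ((restrictedTateRep W (Place.Completion (Sum.inr ((primesEquiv (R := 𝓞 ℚ)).symm ⟨p, hp.out⟩) : Place ℚ)) p).restrict (absGaloisRestrict (Place.Completion (Sum.inr ((primesEquiv (R := 𝓞 ℚ)).symm ⟨p, hp.out⟩) : Place ℚ)) (w.1.adicCompletion (CyclotomicField m ℚ)))).toTopRep)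
        (P : (W.baseChange (w.1.adicCompletion (CyclotomicField m ℚ))).toAffine.Point),
        ((tatePairingPointTower W (Place.Completion (Sum.inr ((primesEquiv (R := 𝓞 ℚ)).symm ⟨p, hp.out⟩) : Place ℚ)) e hμ hadd₁ hadd₂ hgal hcompat (oneCocycleClass _ η) P : ℤ_[p]) : ℚ_[p]) =
          Algebra.trace ℚ_[p] (w.1.adicCompletion (CyclotomicField m ℚ))
            (algebraMap (Place.Completion (Sum.inr ((primesEquiv (R := 𝓞 ℚ)).symm ⟨p, hp.out⟩) : Place ℚ)) (w.1.adicCompletion (CyclotomicField m ℚ)) c₀ * expStarCoordTower W hL d η * padicLogPointFiniteExt ν (W.baseChange (w.1.adicCompletion (CyclotomicField m ℚ))) p P) := by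
  intro wv _ _ ν _ _ K _ _ _ _ w' hw' _ _ _ hp' ω' _ _
  exact recTowerAt_cyclotomic_cells_of_formula_over_ext W p hp57 hadd hirr hIstar h4 m w hw hL wv ν hp'
    (w'.adicCompletionSemialgHom_continuous (CyclotomicField m ℚ) K) ω'

end Summit.BirchSwinnertonDyer.BirchSwinnertonDyer.Theorems.StarredOptimalManinUnitFiveSevenRecTowerAtCyclotomicOverCompletion

end
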